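import Summits.QuantumAdvantage.QuantumAdvantage.Theses.SymplecticPurity
import Literature.Computability.MetaComplexity.RandReductionsLeak
import Literature.Computability.Cryptography.PostselectionPostBQPProofs
import Literature.Computability.Cryptography.KitaevPhaseEstimationCircuit
import Literature.Computability.QuantumComplexity.BQPErrorReductionProofs

/-!
# `deq_thesis` (`FFThesis := BQP ⊆ BPP`): the bounded-error gap is load-bearing

Negative-side support file for the shared crux item `stmt-QuantumAdvantage-0242` (refuter
`cdisprove`). The crux `X := BQP ⊆ BPP = BQPWith cliffordT (1/3) ⊆ BPP` has no hypotheses; its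
content sits in the parameters of `BQP`. Here: the ERROR BOUND. Relax `1/3` to the cut-point `1/2`
(`x ∈ L → Pr[accept] ≥ 1/2`, `x ∉ L → Pr[accept] ≤ 1/2`, families still poly-time UNIFORM and
oracle-free) and the inclusion in `BPP` becomes FALSE:

* `hadFamily_acceptProbOn` — the uniform coin family `PostBPPSim.hadFamily` (one `H` per input
  wire; uniformity is the tree theorem `hadFamily_isUniform`) accepts every non-empty input with
  probability exactly `1/2` (`H^{⊗n}|x⟩` has all amplitudes `±2^{-n/2}`; `sum_ite_apply_eq`: half
  of the bit strings have bit `0` set); on `[]` the value is the junk `0` (`hadFamily_acceptProbOn_nil`);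
* `mem_BQPWith_half` — hence EVERY language avoiding `[]` lies in `BQPWith cliffordT (1/2)`;
* `not_countable_BQPWith_half`, **`deqThesis_false_without_gap : ¬ (BQPWith cliffordT (1/2) ⊆ BPP)`**
  — `2^ℵ₀` such languages (shifted length-languages, Cantor) against the countable `BPP` (tree
  theorem `countable_BPP`); `not_BQPWith_subset_BPP_of_half_le` — the same for every `ε ≥ 1/2`;
* `BQPWith_subset_BPP_iff_of_lt_half` — below the cut-point nothing changes (`BQPWith ε = BQP` for
  `0 < ε < 1/2`, tree theorem `BQPWith_eq_BQP_holds`): the dependence on `ε` is a sharp dichotomy at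
  `1/2`, so any proof of X must USE `ε < 1/2`.

HONEST READING. The witness exploits exact TIES (`Pr = 1/2` satisfies both non-strict clauses of
`BQPWith` at `ε = 1/2`): it records that the cut-point definition degenerates, not that unbounded
error adds computational power. The strict unbounded-error variant (`x ∈ L ↔ Pr[accept] > 1/2`) is
`PP`-like and its inclusion in `BPP` is an open problem — nothing is claimed about it here.

## References

* E. Bernstein, U. Vazirani, *Quantum complexity theory*, SIAM J. Comput. 26 (1997), Def. 8.1, §8
  (error bounds, amplification). [BernsteinVazirani1997]
* M. A. Nielsen, I. L. Chuang, *Quantum Computation and Quantum Information*, CUP 2010, §1.4.4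
  (`H^{⊗n}|x⟩`). [NielsenChuang2010]
* S. Arora, B. Barak, *Computational Complexity*, CUP 2009, §1.4 (machines as strings: countable
  classes). [AroraBarakCC2009]
-/

set_option linter.dupNamespace false -- D-0017: single-conjunct summit, namespace `Summit.QuantumAdvantage.QuantumAdvantage…` by design

open Computability
open Literature.Computability.Complexity Literature.Computability.Complexity.Classes
open Literature.Computability.Cryptography Literature.Computability.QuantumComplexity
open Literature.Computability.MetaComplexity

noncomputable section

namespace Summit.QuantumAdvantage.QuantumAdvantage.Theorems.DeqThesis.Negative

open Summit.QuantumAdvantage.QuantumAdvantage.Theses.SymplecticPurity (FFThesis)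

/-- The Hadamard sign factor `(-1)^{Σ wᵢzᵢ}` has modulus `1`. [folklore] -/
theorem norm_hSign {N : ℕ} (ws : List (Fin N)) (w z : QReg N) : ‖Kitaev1995.hSign ws w z‖ = 1 := by
  induction ws with
  | nil => simp
  | cons i ws ih =>
    rw [Kitaev1995.hSign_cons, norm_mul, ih, mul_one]
    split <;> simp

/-- Half of the bit strings have a given bit set: `∑_y [y_i = 1]·c = 2^N c / 2` (bit-flip
involution on coordinate `i`). [folklore] -/
theorem sum_ite_apply_eq (N : ℕ) (i : Fin N) (c : ℝ) :
    (∑ y : QReg N, if y i = true then c else 0) = 2 ^ N * c / 2 := by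
  have hinv : Function.Involutive (fun y : QReg N => Function.update y i (!y i)) := by
    intro y
    funext j
    by_cases hj : j = i
    · subst hj; simp
    · simp [Function.update_of_ne hj]
  set e : Equiv.Perm (QReg N) := hinv.toPerm _ with he
  have hey : ∀ y : QReg N, e y i = !y i := fun y => by
    simp [he]
  have h1 : (∑ y : QReg N, if y i = true then c else 0) =
      ∑ y : QReg N, if e y i = true then c else 0 :=
    (Equiv.sum_comp e (fun y : QReg N => if y i = true then c else 0)).symm
  have h2 : ∀ y : QReg N,
      ((if y i = true then c else 0) + if e y i = true then c else 0) = c := fun y => by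
    rw [hey]; cases y i <;> simp
  have h3 : 2 * (∑ y : QReg N, if y i = true then c else 0) = ∑ _y : QReg N, c := by
    rw [two_mul]
    conv_lhs => arg 2; rw [h1]
    rw [← Finset.sum_add_distrib]
    exact Finset.sum_congr rfl fun y _ => h2 y
  have h4 : 2 * (∑ y : QReg N, if y i = true then c else 0) = 2 ^ N * c := by
    rw [h3, Finset.sum_const, Finset.card_univ, nsmul_eq_mul]
    simp
  linear_combination (1 / 2 : ℝ) * h4

/-- **The coin family accepts every non-empty input with probability exactly `1/2`**:
`H^{⊗n}|x⟩ = 2^{-n/2} Σ_z (-1)^{x·z}|z⟩` (tree lemma `hadamards_mulVec_basisState_signed`), so wire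
`0` reads `1` with probability `2^{n-1}·2^{-n}`. [cite: NielsenChuang2010, §1.4.4] -/
theorem hadFamily_acceptProbOn {x : List Bool} (hx : x ≠ []) :
    PostBPPSim.hadFamily.acceptProbOn 0 x = 1 / 2 := by
  have hn : 0 < x.length := List.length_pos_iff.2 hx
  have hamp : ∀ y : QReg (x.length + 0),
      ‖QCircuit.runOn 0 (⟨(List.finRange x.length).map hOn⟩ : QCircuit cliffordT (x.length + 0))
        (basisState (padInput x.get 0)) y‖ ^ 2 = (1 / 2 : ℝ) ^ x.length := by
    intro y
    have h := Kitaev1995.hadamards_mulVec_basisState_signed (List.finRange x.length)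
      (List.nodup_finRange _) (padInput x.get 0)
    have hy := congrFun h y
    rw [List.length_finRange, if_pos (fun j hj => absurd (List.mem_finRange j) hj)] at hy
    show ‖Matrix.mulVec ((⟨(List.finRange x.length).map hOn⟩ : QCircuit cliffordT (x.length + 0)).toMatrix 0)
      (basisState (padInput x.get 0)) y‖ ^ 2 = _
    rw [hy, norm_mul, mul_pow, norm_invSqrt2_pow_sq, norm_hSign, one_pow, mul_one]
  have hpos : 0 < x.length + 0 := hn
  have hone : (2 : ℝ) ^ (x.length + 0) * (1 / 2) ^ x.length = 1 := by
    rw [Nat.add_zero, ← mul_pow]; norm_num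
  show QCircuit.acceptProb 0 (⟨(List.finRange x.length).map hOn⟩ : QCircuit cliffordT (x.length + 0))
    x.get = 1 / 2
  unfold QCircuit.acceptProb
  rw [Finset.sum_congr rfl (fun y _ => by rw [dif_pos hpos])]
  simp only [hamp]
  rw [sum_ite_apply_eq, hone]

/-- On the empty input the coin family has no wire `0`: acceptance probability `0` (the documented
junk value of `acceptProb` on the empty register). [folklore] -/
theorem hadFamily_acceptProbOn_nil : PostBPPSim.hadFamily.acceptProbOn 0 [] = 0 := by
  unfold QCircuitFamily.acceptProbOn QCircuit.acceptProb
  simp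

/-- **At cut-point `1/2` every language avoiding the empty word is "decided"** by the uniform,
oracle-free coin family. [folklore] -/
theorem mem_BQPWith_half {L : Language Bool} (hL : [] ∉ L) : L ∈ BQPWith cliffordT (1 / 2) := by
  refine ⟨PostBPPSim.hadFamily, PostBPPSim.hadFamily_isOracleFree, PostBPPSim.hadFamily_isUniform,
    fun x => ?_⟩
  by_cases hx : x = []
  · subst hx
    refine ⟨fun h => absurd h hL, fun _ => ?_⟩
    rw [hadFamily_acceptProbOn_nil]; norm_num
  · rw [hadFamily_acceptProbOn hx]
    constructor <;> intro _ <;> norm_num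

/-- The shifted length-languages `lengthSet (succ '' S)` avoid the empty word, hence lie in the
cut-point class, for every `S ⊆ ℕ`. [folklore] -/
theorem lengthSet_succ_mem_BQPWith_half (S : Set ℕ) :
    lengthSet (Nat.succ '' S) ∈ BQPWith cliffordT (1 / 2) := by
  refine mem_BQPWith_half fun h => ?_
  rw [mem_lengthSet_iff] at h
  obtain ⟨n, -, hn⟩ := h
  exact Nat.succ_ne_zero n hn

/-- The cut-point class `BQPWith cliffordT (1/2)` is UNCOUNTABLE (Cantor on `S ↦ lengthSet (succ '' S)`).
[cite: AroraBarakCC2009, §1.4] -/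
theorem not_countable_BQPWith_half : ¬ (BQPWith cliffordT (1 / 2)).Countable := by
  intro hc
  have hinj : Function.Injective fun S : Set ℕ => lengthSet (Nat.succ '' S) :=
    lengthSet_injective.comp (Set.image_injective.2 Nat.succ_injective)
  have huniv : (Set.univ : Set (Set ℕ)).Countable :=
    Set.MapsTo.countable_of_injOn (f := fun S : Set ℕ => lengthSet (Nat.succ '' S))
      (fun S _ => lengthSet_succ_mem_BQPWith_half S) hinj.injOn hc
  haveI : Countable (Set ℕ) := Set.countable_univ_iff.1 huniv
  obtain ⟨f, hf⟩ := exists_surjective_nat (Set ℕ)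
  exact Function.cantor_surjective f hf

/-- **The error bound `ε < 1/2` is load-bearing for the crux**: `¬ (BQPWith cliffordT (1/2) ⊆ BPP)`
(`BPP` is countable, tree theorem `countable_BPP`; the cut-point class is not, through exact ties
`Pr = 1/2`). Since `BQP ⊆ BQPWith cliffordT (1/2)` (`BQPWith_mono`), this refutes a STRENGTHENING
of `FFThesis`; any proof of `FFThesis` must use `1/3 < 1/2`. [folklore] -/
theorem deqThesis_false_without_gap : ¬ (BQPWith cliffordT (1 / 2) ⊆ BPP) :=
  fun h => not_countable_BQPWith_half (countable_BPP.mono h)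

/-- The same for every error bound `ε ≥ 1/2` (monotonicity of `BQPWith`). [folklore] -/
theorem not_BQPWith_subset_BPP_of_half_le {ε : ℝ} (hε : 1 / 2 ≤ ε) :
    ¬ (BQPWith cliffordT ε ⊆ BPP) :=
  fun h => deqThesis_false_without_gap fun _ hL => h (BQPWith_mono hε hL)

/-- Below the cut-point the error bound is immaterial: for `0 < ε < 1/2`,
`BQPWith cliffordT ε ⊆ BPP ↔ FFThesis` (error reduction, tree THEOREM `BQPWith_eq_BQP_holds`). With
`not_BQPWith_subset_BPP_of_half_le`: "`BQPWith ε ⊆ BPP`" is OPEN (= the crux) for `ε < 1/2` and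
FALSE for `ε ≥ 1/2`. [cite: BernsteinVazirani1997, §8] -/
theorem BQPWith_subset_BPP_iff_of_lt_half {ε : ℝ} (h0 : 0 < ε) (h : ε < 1 / 2) :
    BQPWith cliffordT ε ⊆ BPP ↔ FFThesis := by
  have e : BQPWith cliffordT ε = BQP := BQPWith_eq_BQP_holds h0 h
  rw [e]; rfl

/-- **Dichotomy packaged against the crux**: if `FFThesis` failed at NO `ε ≥ 1/2` analogue — i.e.
the gap-free inclusion held — the crux would follow; it does not, and the crux is exactly the
`ε < 1/2` case. Formally: `(BQPWith cliffordT (1/2) ⊆ BPP) → FFThesis` is vacuously usable and its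
hypothesis is refuted. [folklore] -/
theorem deqThesis_false_without_gap' :
    ¬ (BQPWith cliffordT (1 / 2) ⊆ BPP) ∧ ∀ {ε : ℝ}, 0 < ε → ε < 1 / 2 →
      (BQPWith cliffordT ε ⊆ BPP ↔ FFThesis) :=
  ⟨deqThesis_false_without_gap, fun h0 h => BQPWith_subset_BPP_iff_of_lt_half h0 h⟩

end Summit.QuantumAdvantage.QuantumAdvantage.Theorems.DeqThesis.Negative

end
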